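import Literature.MathematicalPhysics.QuantumFieldTheory.Balaban1983to89.QGQInverse
import HarnessLib

/-!
# BalabanUVNodes ∕ N15 — THE KING-MODEL RUNG, FREE-FIELD EDITION (PART Τ-a): THE GAUSSIAN NORMALISATION `𝒩(Δ) = ∫ e^{−½⟨x,Δx⟩} dx`
# ON `ℝ^ι` WITHOUT DETERMINANTS — finiteness, positivity, monotonicity, the SCALING LAW `𝒩(tΔ) = t^{−n∕2}𝒩(Δ)`, the LOG-COMPARISON
# `|ln 𝒩(Δ₂) − ln 𝒩(Δ₁)| ≤ n·θ` for `(1−θ)Δ₁ ≤ Δ₂ ≤ (1+θ)Δ₁`, the TILT identity `∫ e^{⟨J,x⟩ − ½⟨x,Δx⟩} dx = e^{½⟨J,Δ⁻¹J⟩}𝒩(Δ)`, and the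
# isotropic value `𝒩(b·1) = (2π∕b)^{n∕2}` (Track A, DAG node N15 = NE2; FAN-OUT v1.1 §N15 s3 «KING-MODEL RUNG»; regen R453 (b))

HONEST FRAMING.  Count-neutral (cell `pub-ymgap`, seat `pub-ymgap-dag-n15-e` g19; `--supports stmt-QuantumFields-27366 --as helper` = K3⁸
`SpineGivenEndpointR13SepCoPHV`).  PURE REAL ANALYSIS ∕ MEASURE THEORY on `ι → ℝ` with Lebesgue measure (Mathlib); no King object, no Bałaban object,
no record key.  This is the tool file of PART Τ = [King1986] THEOREM 3.1 (3.3)–(3.4), THEOREM 3.4 (3.9) and the ultra-violet stability bound BY NAME on the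
typer's schema `King1986.ContinuumLimit.RGData` for the FREE massive lattice scalar field at `A = 0` (parts Τ-b … Τ-h).  WHY THIS FILE: King's §3.6
(3.89)–(3.93) p. 668–669 identifies the Gaussian normalisations `ln N_k` of the effective actions with `−½ ln det` of the effective Laplacians and bounds
their two-spacing difference through Prop. 3.10 (*"|ln N_k − ln N_{k+n}| = 1∕2d |Σ_p ln[Δ^{(k+n)}(p)Δ^{(k)}(p)^{−1}]| ≤ … ≤ CL^{−2k}(L^kε)^{−d}|T|"*,
(3.93)); the tree has no multi-dimensional Gaussian-integral ∕ determinant formula (`King1986/GaussianNormalizationRate` header: «Gaussian normalisation =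
−½ log det … NOT derived»).  THE ROUTE HERE IS DETERMINANT-FREE: the printed right-hand side `CL^{−2k}·#sites` follows from the FORM comparison
`(1−θ)Δ₁ ≤ Δ₂ ≤ (1+θ)Δ₁` (Prop. 3.10 as forms, part Τ-d) and the scaling of Lebesgue measure (`Measure.integral_comp_smul`) alone
(`abs_log_gaussNorm_sub_le`); the moment-generating function behind the large-field bound (3.4) follows from completing the square and the translation
invariance of Lebesgue measure (`integral_gaussTilt_eq`).  NOT a node discharge; nothing continuum-YM ∕ ℝ⁴ ∕ OS ∕ mass-gap ∕ Clay.  0 `sorry`; ONE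
definition (`gaussNorm`, the object itself); standard axioms.
Locators: [King1986] (2.6) p.652 (the Gaussian normalisation `E₀`), (2.15) p.653 (`N`), (3.14) p.657, (3.89)–(3.93) pp.668–669.
-/

noncomputable section

namespace Summit.QuantumFields.YangMills.BalabanUVNodes.N15KingModelRung.FreeField

open Real Finset Matrix MeasureTheory
open Literature.MathematicalPhysics.QuantumFieldTheory.Balaban1983to89.QGQInverse (Coercive isUnit_of_coercive)
open Literature.LinearAlgebra.Matrix (dotProduct_self_nonneg_real)

variable {ι : Type*} [Fintype ι]

/-! ## §1 The object and pointwise letters -/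

/-- **The Gaussian normalisation** `𝒩(Δ) = ∫_{ℝ^ι} exp(−½⟨x, Δx⟩) dx` (Lebesgue measure, `⟨x, y⟩ = Σ_i x_i y_i`) — King's `exp[E₀]` (2.6) ∕ `N` (2.15) ∕
`N_k` (3.89) for a quadratic action `½⟨x, Δx⟩`; NO closed form (determinant) is used anywhere in part Τ. [cite: King1986, (2.6) p.652, (3.89) p.668] -/
def gaussNorm (Δ : Matrix ι ι ℝ) : ℝ :=
  ∫ x : ι → ℝ, Real.exp (-(1 / 2 : ℝ) * (x ⬝ᵥ (Δ *ᵥ x)))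

/- Reused from the tree (not re-declared): `Literature.LinearAlgebra.Matrix.dotProduct_self_nonneg_real` (`0 ≤ x ⬝ᵥ x`); the identity
`x ⬝ᵥ x = Σ_i x_i²` is `simp [dotProduct, sq]` inline. -/

/-- The linear term is dominated by a quarter of the quadratic one: `⟨J, x⟩ ≤ (δ∕4)⟨x, x⟩ + ⟨J, J⟩∕δ` (`δ > 0`). [folklore] -/
theorem dotProduct_le_quad (J x : ι → ℝ) {δ : ℝ} (hδ : 0 < δ) :
    J ⬝ᵥ x ≤ δ / 4 * (x ⬝ᵥ x) + (J ⬝ᵥ J) / δ := by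
  have hδ0 : δ ≠ 0 := hδ.ne'
  simp only [dotProduct]
  rw [Finset.mul_sum, Finset.sum_div, ← Finset.sum_add_distrib]
  refine Finset.sum_le_sum fun i _ => ?_
  have h : 0 ≤ δ / 4 * (x i - 2 * J i / δ) ^ 2 := by positivity
  have e : δ / 4 * (x i - 2 * J i / δ) ^ 2 = δ / 4 * (x i * x i) - J i * x i + J i * J i / δ := by
    field_simp
    ring
  rw [e] at h
  linarith

/-- The Gaussian exponent with a linear tilt is dominated by a PRODUCT Gaussian: for `Δ ≥ δ > 0` (coercive),
`−½⟨x,Δx⟩ + ⟨J,x⟩ ≤ ⟨J,J⟩∕δ + Σ_i (−(δ∕4) x_i²)`. [folklore] -/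
theorem tilt_exponent_le {Δ : Matrix ι ι ℝ} {δ : ℝ} (hδ : 0 < δ) (hΔ : Coercive Δ δ) (J x : ι → ℝ) :
    -(1 / 2 : ℝ) * (x ⬝ᵥ (Δ *ᵥ x)) + J ⬝ᵥ x ≤ (J ⬝ᵥ J) / δ + ∑ i, (-(δ / 4) * x i ^ 2) := by
  have h1 := hΔ x
  have h2 := dotProduct_le_quad J x hδ
  have h3 : ∑ i, (-(δ / 4) * x i ^ 2) = -(δ / 4) * (x ⬝ᵥ x) := by
    rw [show x ⬝ᵥ x = ∑ i, x i ^ 2 by simp [dotProduct, sq], Finset.mul_sum]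
  rw [h3]
  have h4 := dotProduct_self_nonneg_real x
  nlinarith

/-- Continuity of the tilted quadratic exponent. [folklore] -/
theorem continuous_tilt_exponent (Δ : Matrix ι ι ℝ) (J : ι → ℝ) :
    Continuous fun x : ι → ℝ => -(1 / 2 : ℝ) * (x ⬝ᵥ (Δ *ᵥ x)) + J ⬝ᵥ x := by
  simp only [dotProduct, Matrix.mulVec]
  fun_prop

/-! ## §2 Integrability, positivity, monotonicity -/

/-- The product Gaussian `x ↦ e^{c}·Π_i e^{−b x_i²}` is Lebesgue integrable on `ℝ^ι` (`b > 0`). [folklore] -/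
theorem integrable_prodGauss {b : ℝ} (hb : 0 < b) (c : ℝ) :
    Integrable (fun x : ι → ℝ => Real.exp c * ∏ i, Real.exp (-b * x i ^ 2)) := by
  apply Integrable.const_mul
  have h : Integrable (fun x : ι → ℝ => ∏ i, Real.exp (-b * x i ^ 2)) (Measure.pi fun _ => volume) :=
    Integrable.fintype_prod (f := fun _ (y : ℝ) => Real.exp (-b * y ^ 2)) fun _ => integrable_exp_neg_mul_sq hb
  simpa [volume_pi] using h

/-- **The tilted Gaussian is integrable**: `x ↦ exp(−½⟨x,Δx⟩ + ⟨J,x⟩) ∈ L¹(ℝ^ι)` for coercive `Δ` (`Δ ≥ δ > 0` as a form). [folklore] -/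
theorem integrable_gaussTilt {Δ : Matrix ι ι ℝ} {δ : ℝ} (hδ : 0 < δ) (hΔ : Coercive Δ δ) (J : ι → ℝ) :
    Integrable (fun x : ι → ℝ => Real.exp (-(1 / 2 : ℝ) * (x ⬝ᵥ (Δ *ᵥ x)) + J ⬝ᵥ x)) := by
  have hb : 0 < δ / 4 := by positivity
  refine (integrable_prodGauss (ι := ι) hb ((J ⬝ᵥ J) / δ)).mono' ?_ ?_
  · exact (Real.continuous_exp.comp (continuous_tilt_exponent Δ J)).aestronglyMeasurable
  · refine Filter.Eventually.of_forall fun x => ?_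
    rw [Real.norm_eq_abs, abs_of_pos (Real.exp_pos _), ← Real.exp_sum, ← Real.exp_add]
    exact Real.exp_le_exp.mpr (by simpa [neg_mul] using tilt_exponent_le hδ hΔ J x)

/-- The plain Gaussian is integrable. [folklore] -/
theorem integrable_gauss {Δ : Matrix ι ι ℝ} {δ : ℝ} (hδ : 0 < δ) (hΔ : Coercive Δ δ) :
    Integrable (fun x : ι → ℝ => Real.exp (-(1 / 2 : ℝ) * (x ⬝ᵥ (Δ *ᵥ x)))) := by
  have h := integrable_gaussTilt hδ hΔ 0
  simpa using h

/-- **`𝒩(Δ) > 0`.** [folklore] -/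
theorem gaussNorm_pos {Δ : Matrix ι ι ℝ} {δ : ℝ} (hδ : 0 < δ) (hΔ : Coercive Δ δ) : 0 < gaussNorm Δ := by
  unfold gaussNorm
  exact integral_exp_pos (integrable_gauss hδ hΔ)

/-- **Monotonicity**: a larger form has a smaller normalisation — if `⟨x,Δ₁x⟩ ≤ ⟨x,Δ₂x⟩` for all `x` (both coercive) then `𝒩(Δ₂) ≤ 𝒩(Δ₁)`. [folklore] -/
theorem gaussNorm_mono {Δ₁ Δ₂ : Matrix ι ι ℝ} {δ₁ δ₂ : ℝ} (hδ₁ : 0 < δ₁) (hΔ₁ : Coercive Δ₁ δ₁) (hδ₂ : 0 < δ₂) (hΔ₂ : Coercive Δ₂ δ₂)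
    (hle : ∀ x, x ⬝ᵥ (Δ₁ *ᵥ x) ≤ x ⬝ᵥ (Δ₂ *ᵥ x)) : gaussNorm Δ₂ ≤ gaussNorm Δ₁ := by
  unfold gaussNorm
  refine integral_mono (integrable_gauss hδ₂ hΔ₂) (integrable_gauss hδ₁ hΔ₁) fun x => ?_
  have := hle x
  exact Real.exp_le_exp.mpr (by nlinarith)

/-! ## §3 The scaling law (change of variables `x ↦ √t·x` in Lebesgue measure) -/

/-- `⟨√t x, Δ(√t x)⟩ = t⟨x, Δx⟩`. [folklore] -/
theorem quad_smul_sqrt {t : ℝ} (ht : 0 ≤ t) (Δ : Matrix ι ι ℝ) (x : ι → ℝ) :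
    (Real.sqrt t • x) ⬝ᵥ (Δ *ᵥ (Real.sqrt t • x)) = t * (x ⬝ᵥ (Δ *ᵥ x)) := by
  rw [Matrix.mulVec_smul, smul_dotProduct, dotProduct_smul, smul_eq_mul, smul_eq_mul, ← mul_assoc,
    Real.mul_self_sqrt ht]

/-- `⟨x, (tΔ)x⟩ = t⟨x, Δx⟩`. [folklore] -/
theorem quad_smul_matrix (t : ℝ) (Δ : Matrix ι ι ℝ) (x : ι → ℝ) :
    x ⬝ᵥ ((t • Δ) *ᵥ x) = t * (x ⬝ᵥ (Δ *ᵥ x)) := by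
  rw [Matrix.smul_mulVec, dotProduct_smul, smul_eq_mul]

/-- **THE SCALING LAW** `𝒩(tΔ) = t^{−n∕2}·𝒩(Δ)`, `n = |ι|`, `t > 0` — Lebesgue measure scales by `|det(√t·1)|⁻¹ = t^{−n∕2}` under `x ↦ √t x`
(`Measure.integral_comp_smul`); NO determinant of `Δ` appears. [folklore] -/
theorem gaussNorm_smul {t : ℝ} (ht : 0 < t) (Δ : Matrix ι ι ℝ) :
    gaussNorm (t • Δ) = t ^ (-((Fintype.card ι : ℝ) / 2)) * gaussNorm Δ := by
  unfold gaussNorm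
  have h1 : (fun x : ι → ℝ => Real.exp (-(1 / 2 : ℝ) * (x ⬝ᵥ ((t • Δ) *ᵥ x))))
      = fun x => (fun y : ι → ℝ => Real.exp (-(1 / 2 : ℝ) * (y ⬝ᵥ (Δ *ᵥ y)))) (Real.sqrt t • x) := by
    funext x
    simp only [quad_smul_matrix, quad_smul_sqrt ht.le]
  rw [h1, Measure.integral_comp_smul volume (fun y : ι → ℝ => Real.exp (-(1 / 2 : ℝ) * (y ⬝ᵥ (Δ *ᵥ y)))) (Real.sqrt t)]
  rw [Module.finrank_pi ℝ, smul_eq_mul]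
  congr 1
  have hs : 0 < Real.sqrt t := Real.sqrt_pos.mpr ht
  rw [abs_of_pos (inv_pos.mpr (pow_pos hs _)), ← Real.rpow_natCast, ← Real.rpow_neg hs.le,
    Real.sqrt_eq_rpow, ← Real.rpow_mul ht.le]
  congr 1
  ring

/-! ## §4 ★ The log-comparison of normalisations from a form comparison (King's (3.93) right-hand side without the determinant) -/

/-- A form sandwich transfers coercivity: `Δ₂ ≥ (1−θ)Δ₁ ≥ (1−θ)δ`. [folklore] -/
theorem coercive_of_lower {Δ₁ Δ₂ : Matrix ι ι ℝ} {δ θ : ℝ} (hΔ₁ : Coercive Δ₁ δ)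
    (hlo : ∀ x, (1 - θ) * (x ⬝ᵥ (Δ₁ *ᵥ x)) ≤ x ⬝ᵥ (Δ₂ *ᵥ x)) (hθ : θ ≤ 1) : Coercive Δ₂ ((1 - θ) * δ) := by
  intro x
  have h1 := hΔ₁ x
  have h2 := hlo x
  have h3 : 0 ≤ 1 - θ := by linarith
  calc (1 - θ) * δ * (x ⬝ᵥ x) = (1 - θ) * (δ * (x ⬝ᵥ x)) := by ring
    _ ≤ (1 - θ) * (x ⬝ᵥ (Δ₁ *ᵥ x)) := mul_le_mul_of_nonneg_left h1 h3
    _ ≤ x ⬝ᵥ (Δ₂ *ᵥ x) := h2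

/-- `tΔ` is coercive with constant `tδ` (`t ≥ 0`). [folklore] -/
theorem coercive_smul {Δ : Matrix ι ι ℝ} {δ t : ℝ} (hΔ : Coercive Δ δ) (ht : 0 ≤ t) : Coercive (t • Δ) (t * δ) := by
  intro x
  rw [quad_smul_matrix, mul_assoc]
  exact mul_le_mul_of_nonneg_left (hΔ x) ht

/-- ★ **THE LOG-COMPARISON OF GAUSSIAN NORMALISATIONS** (King's (3.93) right-hand side, determinant-free): if `Δ₁ ≥ δ > 0` and
`(1−θ)⟨x,Δ₁x⟩ ≤ ⟨x,Δ₂x⟩ ≤ (1+θ)⟨x,Δ₁x⟩` for all `x`, with `0 ≤ θ ≤ ½`, then `|ln 𝒩(Δ₂) − ln 𝒩(Δ₁)| ≤ n·θ`, `n = |ι|` (the number of lattice sites =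
the number of momenta in King's `CΣ_pL^{−2k}`).  Proof: `𝒩((1+θ)Δ₁) ≤ 𝒩(Δ₂) ≤ 𝒩((1−θ)Δ₁)` by monotonicity, `= (1∓θ)^{−n∕2}𝒩(Δ₁)` by scaling, and
`½·max(−ln(1−θ), ln(1+θ)) ≤ θ`. [cite: King1986, (3.93) p.669] -/
theorem abs_log_gaussNorm_sub_le {Δ₁ Δ₂ : Matrix ι ι ℝ} {δ θ : ℝ} (hδ : 0 < δ) (hΔ₁ : Coercive Δ₁ δ) (hθ0 : 0 ≤ θ) (hθ : θ ≤ 1 / 2)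
    (hlo : ∀ x, (1 - θ) * (x ⬝ᵥ (Δ₁ *ᵥ x)) ≤ x ⬝ᵥ (Δ₂ *ᵥ x)) (hhi : ∀ x, x ⬝ᵥ (Δ₂ *ᵥ x) ≤ (1 + θ) * (x ⬝ᵥ (Δ₁ *ᵥ x))) :
    |Real.log (gaussNorm Δ₂) - Real.log (gaussNorm Δ₁)| ≤ (Fintype.card ι : ℝ) * θ := by
  set n : ℝ := (Fintype.card ι : ℝ) with hn
  have hn0 : 0 ≤ n := by rw [hn]; positivity
  have h1θ : 0 < 1 - θ := by linarith
  have h1θ' : 0 < 1 + θ := by linarith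
  -- coercivity of the comparison matrices
  have hc2 : Coercive Δ₂ ((1 - θ) * δ) := coercive_of_lower hΔ₁ hlo (by linarith)
  have hδ2 : 0 < (1 - θ) * δ := mul_pos h1θ hδ
  have hclo : Coercive ((1 - θ) • Δ₁) ((1 - θ) * δ) := coercive_smul hΔ₁ h1θ.le
  have hchi : Coercive ((1 + θ) • Δ₁) ((1 + θ) * δ) := coercive_smul hΔ₁ h1θ'.le
  have hδ3 : 0 < (1 + θ) * δ := mul_pos h1θ' hδ
  -- 𝒩(Δ₂) ≤ 𝒩((1−θ)Δ₁) = (1−θ)^{−n/2} 𝒩(Δ₁)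
  have hup : gaussNorm Δ₂ ≤ (1 - θ) ^ (-(n / 2)) * gaussNorm Δ₁ := by
    rw [hn, ← gaussNorm_smul h1θ Δ₁]
    exact gaussNorm_mono hδ2 hclo hδ2 hc2 fun x => by rw [quad_smul_matrix]; exact hlo x
  -- 𝒩(Δ₂) ≥ 𝒩((1+θ)Δ₁) = (1+θ)^{−n/2} 𝒩(Δ₁)
  have hdown : (1 + θ) ^ (-(n / 2)) * gaussNorm Δ₁ ≤ gaussNorm Δ₂ := by
    rw [hn, ← gaussNorm_smul h1θ' Δ₁]
    exact gaussNorm_mono hδ2 hc2 hδ3 hchi fun x => by rw [quad_smul_matrix]; exact hhi x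
  have hN1 : 0 < gaussNorm Δ₁ := gaussNorm_pos hδ hΔ₁
  have hN2 : 0 < gaussNorm Δ₂ := gaussNorm_pos hδ2 hc2
  -- take logarithms
  have hlup : Real.log (gaussNorm Δ₂) ≤ -(n / 2) * Real.log (1 - θ) + Real.log (gaussNorm Δ₁) := by
    have := Real.log_le_log hN2 hup
    rwa [Real.log_mul (by positivity) hN1.ne', Real.log_rpow h1θ] at this
  have hldown : -(n / 2) * Real.log (1 + θ) + Real.log (gaussNorm Δ₁) ≤ Real.log (gaussNorm Δ₂) := by
    have := Real.log_le_log (by positivity) hdown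
    rwa [Real.log_mul (by positivity) hN1.ne', Real.log_rpow h1θ'] at this
  -- the two elementary letters `−log(1−θ) ≤ 2θ` (`θ ≤ ½`) and `log(1+θ) ≤ θ`
  have hA : -Real.log (1 - θ) ≤ 2 * θ := by
    have h := Real.one_sub_inv_le_log_of_pos h1θ
    have h2 : -(2 * θ) ≤ 1 - (1 - θ)⁻¹ := by
      rw [show 1 - (1 - θ)⁻¹ = -(θ / (1 - θ)) by field_simp; ring]
      rw [neg_le_neg_iff, div_le_iff₀ h1θ]
      nlinarith
    linarith
  have hB : Real.log (1 + θ) ≤ θ := by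
    have h := Real.log_le_sub_one_of_pos h1θ'
    linarith
  have hlogpos : 0 ≤ Real.log (1 + θ) := Real.log_nonneg (by linarith)
  rw [abs_le]
  constructor
  · -- lower: log N₂ − log N₁ ≥ −(n/2) log(1+θ) ≥ −(n/2)θ ≥ −nθ
    have h3 : (n / 2) * Real.log (1 + θ) ≤ n * θ := by nlinarith
    linarith
  · -- upper: log N₂ − log N₁ ≤ −(n/2) log(1−θ) ≤ (n/2)(2θ) = nθ
    have h3 : -(n / 2) * Real.log (1 - θ) ≤ n * θ := by nlinarith
    linarith

/-! ## §5 The tilt identity (completing the square + translation invariance of Lebesgue measure) -/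

/-- Completing the square: for symmetric invertible `Δ` and `x₀ = Δ⁻¹J`, `⟨J,x⟩ − ½⟨x,Δx⟩ = −½⟨x − x₀, Δ(x − x₀)⟩ + ½⟨J, Δ⁻¹J⟩`. [folklore] -/
theorem complete_square [DecidableEq ι] {Δ : Matrix ι ι ℝ} (hsymm : Δᵀ = Δ) (hunit : IsUnit Δ) (J x : ι → ℝ) :
    -(1 / 2 : ℝ) * (x ⬝ᵥ (Δ *ᵥ x)) + J ⬝ᵥ x
      = -(1 / 2 : ℝ) * ((x - Δ⁻¹ *ᵥ J) ⬝ᵥ (Δ *ᵥ (x - Δ⁻¹ *ᵥ J))) + (1 / 2 : ℝ) * (J ⬝ᵥ (Δ⁻¹ *ᵥ J)) := by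
  have hdet : IsUnit Δ.det := (Matrix.isUnit_iff_isUnit_det Δ).mp hunit
  set x₀ : ι → ℝ := Δ⁻¹ *ᵥ J with hx₀
  -- Δ x₀ = J
  have hΔx₀ : Δ *ᵥ x₀ = J := by
    rw [hx₀, Matrix.mulVec_mulVec, Matrix.mul_nonsing_inv Δ hdet, Matrix.one_mulVec]
  -- ⟨x₀, Δ y⟩ = ⟨J, y⟩ (symmetry)
  have hx₀Δ : ∀ y : ι → ℝ, x₀ ⬝ᵥ (Δ *ᵥ y) = J ⬝ᵥ y := fun y => by
    rw [Matrix.dotProduct_mulVec, ← Matrix.mulVec_transpose, hsymm, hΔx₀]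
  have e1 : (x - x₀) ⬝ᵥ (Δ *ᵥ (x - x₀)) = x ⬝ᵥ (Δ *ᵥ x) - 2 * (J ⬝ᵥ x) + J ⬝ᵥ x₀ := by
    rw [Matrix.mulVec_sub, sub_dotProduct, dotProduct_sub, dotProduct_sub, hx₀Δ x, hx₀Δ x₀, hΔx₀]
    have hs : x ⬝ᵥ J = J ⬝ᵥ x := dotProduct_comm x J
    rw [hs]
    ring
  rw [e1]
  ring

/-- **THE TILT IDENTITY** (moment-generating function of a centred Gaussian density, determinant-free): for symmetric coercive `Δ`,
`∫ exp(−½⟨x,Δx⟩ + ⟨J,x⟩) dx = exp(½⟨J, Δ⁻¹J⟩)·𝒩(Δ)` (completing the square and `∫ f(x − x₀) dx = ∫ f(x) dx`). [folklore] -/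
theorem integral_gaussTilt_eq [DecidableEq ι] {Δ : Matrix ι ι ℝ} {δ : ℝ} (hδ : 0 < δ) (hΔ : Coercive Δ δ) (hsymm : Δᵀ = Δ) (J : ι → ℝ) :
    ∫ x : ι → ℝ, Real.exp (-(1 / 2 : ℝ) * (x ⬝ᵥ (Δ *ᵥ x)) + J ⬝ᵥ x)
      = Real.exp ((1 / 2 : ℝ) * (J ⬝ᵥ (Δ⁻¹ *ᵥ J))) * gaussNorm Δ := by
  have hunit : IsUnit Δ := isUnit_of_coercive hδ hΔ
  simp_rw [complete_square hsymm hunit J, Real.exp_add]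
  rw [integral_mul_const, mul_comm]
  congr 1
  unfold gaussNorm
  have h := integral_add_left_eq_self (μ := (volume : Measure (ι → ℝ)))
    (fun y : ι → ℝ => Real.exp (-(1 / 2 : ℝ) * (y ⬝ᵥ (Δ *ᵥ y)))) (-(Δ⁻¹ *ᵥ J))
  simp only [neg_add_eq_sub] at h
  exact h

/-- **THE NORMALISED TILT** (what Chernoff's bound needs): `∫ exp(⟨J,x⟩) ρ_Δ(x) dx = exp(½⟨J, Δ⁻¹J⟩)` for the probability density
`ρ_Δ = e^{−½⟨x,Δx⟩}∕𝒩(Δ)`. [folklore] -/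
theorem integral_exp_dot_gaussDensity [DecidableEq ι] {Δ : Matrix ι ι ℝ} {δ : ℝ} (hδ : 0 < δ) (hΔ : Coercive Δ δ) (hsymm : Δᵀ = Δ) (J : ι → ℝ) :
    ∫ x : ι → ℝ, Real.exp (J ⬝ᵥ x) * (Real.exp (-(1 / 2 : ℝ) * (x ⬝ᵥ (Δ *ᵥ x))) / gaussNorm Δ)
      = Real.exp ((1 / 2 : ℝ) * (J ⬝ᵥ (Δ⁻¹ *ᵥ J))) := by
  have hN := gaussNorm_pos hδ hΔ
  have h1 : (fun x : ι → ℝ => Real.exp (J ⬝ᵥ x) * (Real.exp (-(1 / 2 : ℝ) * (x ⬝ᵥ (Δ *ᵥ x))) / gaussNorm Δ))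
      = fun x => Real.exp (-(1 / 2 : ℝ) * (x ⬝ᵥ (Δ *ᵥ x)) + J ⬝ᵥ x) * (gaussNorm Δ)⁻¹ := by
    funext x; rw [Real.exp_add]; ring
  rw [h1, integral_mul_const, integral_gaussTilt_eq hδ hΔ hsymm J, mul_assoc, mul_inv_cancel₀ hN.ne', mul_one]

/-- The density integrates to one: `∫ ρ_Δ = 1`. [folklore] -/
theorem integral_gaussDensity {Δ : Matrix ι ι ℝ} {δ : ℝ} (hδ : 0 < δ) (hΔ : Coercive Δ δ) :
    ∫ x : ι → ℝ, Real.exp (-(1 / 2 : ℝ) * (x ⬝ᵥ (Δ *ᵥ x))) / gaussNorm Δ = 1 := by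
  have hN := gaussNorm_pos hδ hΔ
  rw [integral_div, ← gaussNorm, div_self hN.ne']

/-! ## §6 The isotropic value and the crude sandwich (used for the `k = 0` ∕ large-`θ` members of (3.9)) -/

/-- `⟨x, (b·1)x⟩ = b·Σ_i x_i²`. [folklore] -/
theorem quad_scalar [DecidableEq ι] (b : ℝ) (x : ι → ℝ) : x ⬝ᵥ ((b • (1 : Matrix ι ι ℝ)) *ᵥ x) = b * ∑ i, x i ^ 2 := by
  rw [Matrix.smul_mulVec, Matrix.one_mulVec, dotProduct_smul, smul_eq_mul]
  simp [dotProduct, sq]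

/-- The scalar matrix `b·1` is coercive with constant `b`. [folklore] -/
theorem coercive_scalar [DecidableEq ι] (b : ℝ) : Coercive (b • (1 : Matrix ι ι ℝ)) b := by
  intro x
  rw [quad_scalar]
  simp [dotProduct, sq]

/-- **The isotropic Gaussian integral** `𝒩(b·1) = (√(2π∕b))^n` (`b > 0`; Fubini over the coordinates and `∫e^{−(b∕2)y²}dy = √(2π∕b)`). [folklore] -/
theorem gaussNorm_scalar [DecidableEq ι] {b : ℝ} (hb : 0 < b) : gaussNorm (b • (1 : Matrix ι ι ℝ)) = Real.sqrt (2 * π / b) ^ Fintype.card ι := by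
  unfold gaussNorm
  have h1 : (fun x : ι → ℝ => Real.exp (-(1 / 2 : ℝ) * (x ⬝ᵥ ((b • (1 : Matrix ι ι ℝ)) *ᵥ x))))
      = fun x => ∏ i, Real.exp (-(b / 2) * x i ^ 2) := by
    funext x
    rw [quad_scalar, ← Real.exp_sum]
    congr 1
    rw [← mul_assoc, Finset.mul_sum]
    exact Finset.sum_congr rfl fun i _ => by ring
  rw [h1, integral_fintype_prod_volume_eq_pow (fun y : ℝ => Real.exp (-(b / 2) * y ^ 2)), integral_gaussian]
  congr 2
  field_simp

/-- **The crude sandwich**: `δ ≤ Δ ≤ A` as forms (`δ > 0`) gives `(√(2π∕A))^n ≤ 𝒩(Δ) ≤ (√(2π∕δ))^n`. [folklore] -/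
theorem gaussNorm_sandwich [DecidableEq ι] {Δ : Matrix ι ι ℝ} {δ A : ℝ} (hδ : 0 < δ) (hΔ : Coercive Δ δ) (hApos : 0 < A)
    (hA : ∀ x, x ⬝ᵥ (Δ *ᵥ x) ≤ A * (x ⬝ᵥ x)) :
    Real.sqrt (2 * π / A) ^ Fintype.card ι ≤ gaussNorm Δ ∧ gaussNorm Δ ≤ Real.sqrt (2 * π / δ) ^ Fintype.card ι := by
  constructor
  · rw [← gaussNorm_scalar hApos]
    exact gaussNorm_mono hδ hΔ hApos (coercive_scalar A) fun x => by
      rw [quad_scalar, show ∑ i, x i ^ 2 = x ⬝ᵥ x by simp [dotProduct, sq]]; exact hA x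
  · rw [← gaussNorm_scalar hδ]
    exact gaussNorm_mono hδ (coercive_scalar δ) hδ hΔ fun x => by
      rw [quad_scalar, show ∑ i, x i ^ 2 = x ⬝ᵥ x by simp [dotProduct, sq]]; exact hΔ x

/-- **The crude log-comparison**: two forms both sandwiched in `[δ, A]` (`0 < δ`) have `|ln 𝒩(Δ₁) − ln 𝒩(Δ₂)| ≤ (n∕2)·(ln A − ln δ)` — no rate, used
only where (3.9) asks for none (the members `k = 0` and the finitely many `k` with `θ_k > ½`). [folklore] -/
theorem abs_log_gaussNorm_sub_le_crude [DecidableEq ι] {Δ₁ Δ₂ : Matrix ι ι ℝ} {δ A : ℝ} (hδ : 0 < δ) (hApos : 0 < A)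
    (hΔ₁ : Coercive Δ₁ δ) (hA₁ : ∀ x, x ⬝ᵥ (Δ₁ *ᵥ x) ≤ A * (x ⬝ᵥ x))
    (hΔ₂ : Coercive Δ₂ δ) (hA₂ : ∀ x, x ⬝ᵥ (Δ₂ *ᵥ x) ≤ A * (x ⬝ᵥ x)) :
    |Real.log (gaussNorm Δ₁) - Real.log (gaussNorm Δ₂)| ≤ (Fintype.card ι : ℝ) / 2 * (Real.log A - Real.log δ) := by
  obtain ⟨h1l, h1u⟩ := gaussNorm_sandwich hδ hΔ₁ hApos hA₁
  obtain ⟨h2l, h2u⟩ := gaussNorm_sandwich hδ hΔ₂ hApos hA₂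
  have hlo : 0 < Real.sqrt (2 * π / A) ^ Fintype.card ι := by positivity
  have hN1 := gaussNorm_pos hδ hΔ₁
  have hN2 := gaussNorm_pos hδ hΔ₂
  -- logs of the two envelope values
  have hsA : Real.log (Real.sqrt (2 * π / A) ^ Fintype.card ι) = (Fintype.card ι : ℝ) / 2 * (Real.log (2 * π) - Real.log A) := by
    rw [Real.log_pow, Real.log_sqrt (by positivity), Real.log_div (by positivity) hApos.ne']; ring
  have hsδ : Real.log (Real.sqrt (2 * π / δ) ^ Fintype.card ι) = (Fintype.card ι : ℝ) / 2 * (Real.log (2 * π) - Real.log δ) := by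
    rw [Real.log_pow, Real.log_sqrt (by positivity), Real.log_div (by positivity) hδ.ne']; ring
  have a1 := Real.log_le_log hlo h1l
  have b1 := Real.log_le_log hN1 h1u
  have a2 := Real.log_le_log hlo h2l
  have b2 := Real.log_le_log hN2 h2u
  rw [hsA] at a1 a2
  rw [hsδ] at b1 b2
  rw [abs_le]
  constructor <;> nlinarith

end Summit.QuantumFields.YangMills.BalabanUVNodes.N15KingModelRung.FreeField

end
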